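import Mathlib
import Literature.MathematicalPhysics.QuantumFieldTheory.Balaban1983to89.B6RandomWalk

/-!
# `Balaban1983to89.B6MajorantReblock` — [Balaban1984PropagatorsII] (2.51)–(2.52) p. 232 across TWO BLOCK STRUCTURES: a block majorant with respect to one
# block map `blk′` (the blocks 𝔅′ of a second sequence {Ω′_j}) yields a block majorant with respect to another block map `blk` (the blocks 𝔅 of {Ω_j})
# by the decomposition `f = Σ_{b′} Δ′(b′)f` and a supplied covering `S(b) ⊇ {b′ : b′ meets b}` — the re-blocking step the resolvent route to
# [Balaban1985BackgroundPropagators] Theorem 3.14 needs for the second operator (one-block-structure engines `B9Thm314ResolventCore∕…Weighted`)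

[B6] = T. Bałaban, *Propagators and renormalization transformations for lattice gauge theories. II*, Commun. Math. Phys. **96** (1984) 223–250, p. 232
(2.51)–(2.52): *"|(R₁λ)(x)| ≤ K₁(y, y′)|λ|, x ∈ B^j(y), supp λ ⊂ B^{j′}(y′) … R₁R₂λ = Σ_{y″} R₁Δ(y″)R₂λ, where Δ(y) = B^j(y) if y ∈ Λ_j"*; B9 = [Balaban1985BackgroundPropagators]
Thm 3.14 pp. 426–427 (two sequences {Ω_j}, {Ω′_j} on one lattice; the tree's flat model does this re-blocking with the block maxima `PhiMax`∕`PsiMax` of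
`B9Thm314GpFlatResolvent`).

WHAT IS PROVED (kernel; [folklore] bookkeeping over `B6RandomWalk.HasMajorant`; DAG node N06 supply, seat `pub-ymgap-dag-n06-a`):
* `blockPiece_eq_zero_of_not_mem` — a `blk′`-piece of a `blk`-block-supported function vanishes unless its block is in the covering family `S (blk-block)`;
* `hasMajorant_reblock` — `HasMajorant blk′ T K′` + a covering `S` (`∀ x, blk′ x ∈ S (blk x)`) + a bound `Σ_{b′ ∈ S b} K′(blk′ x, b′) ≤ K(blk x, b)` for all `x`, `b`
  ⇒ `HasMajorant blk T K` (no sign condition on `K′`);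
* `hasMajorant_reblock_exp` — the exponential form: `K′ ≤ C′w′(a′)e^{−δd′}` + weight comparison + distance comparison `d(blk x, b) ≤ d′(blk′ x, b′) + r` on the
  covering family + its summability at half the rate ⇒ the `blk`-majorant `C′c′e^{(δ/2)r}·w(a)·e^{−(δ/2)d(a,b)}`.
HONEST SCOPE: pure bookkeeping; the geometric content (how many 𝔅′-blocks meet a 𝔅-block and how their majorants compare — (2.60)) is the consumer's `S` and bound;
count-neutral; NOT continuum ∕ Clay.
-/

namespace Literature.MathematicalPhysics.QuantumFieldTheory.Balaban1983to89.B6MajorantReblock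

open Finset
open Literature.MathematicalPhysics.QuantumFieldTheory.Balaban1983to89.B6RandomWalk (HasMajorant BlockSupp blockPiece sum_blockPiece
  blockSupp_blockPiece)

variable {g g' : B6.Geometry} {X : Type}

/-- A `blk′`-piece of a function supported in the `blk`-block `b` VANISHES when its `blk′`-block is outside a family `S b` containing every `blk′`-block that
meets `b`. [cite: Balaban1984PropagatorsII, (2.52) p.232 (bookkeeping)] -/
theorem blockPiece_eq_zero_of_not_mem (blk : X → g.Site) (blk' : X → g'.Site) (S : g.Site → Finset g'.Site)
    (hS : ∀ x : X, blk' x ∈ S (blk x)) {μ : X → ℝ} {b : g.Site} {B : ℝ} (hμ : BlockSupp blk μ b B) {b' : g'.Site}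
    (hb' : b' ∉ S b) : blockPiece blk' b' μ = 0 := by
  classical
  funext x
  simp only [blockPiece, Pi.zero_apply]
  split_ifs with hx
  · -- `blk′ x = b′ ∉ S b`, so `blk x ≠ b`, so `μ x = 0`
    have hxb : blk x ≠ b := by
      intro hxb
      exact hb' (hxb ▸ hx ▸ hS x)
    exact hμ.off x hxb
  · rfl

/-- **RE-BLOCKING A MAJORANT** ([4] (2.51)–(2.52) across two block structures): if `T` has the majorant `K′` with respect to the block map `blk′`, `S b`
contains every `blk′`-block meeting the `blk`-block `b`, and `Σ_{b′ ∈ S b} K′(blk′ x, b′) ≤ K(blk x, b)` for all `x`, `b`, then `T` has the majorant `K` with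
respect to `blk`.  (Decompose a `blk`-block-supported `λ` as `Σ_{b′} Δ′(b′)λ`; the pieces off `S b` vanish.) [cite: Balaban1984PropagatorsII, (2.51)–(2.52) p.232 (bookkeeping across two block structures); Balaban1985BackgroundPropagators, Thm 3.14 pp.426–427 (the two sequences)] -/
theorem hasMajorant_reblock (blk : X → g.Site) (blk' : X → g'.Site) (S : g.Site → Finset g'.Site) (hS : ∀ x : X, blk' x ∈ S (blk x))
    {T : Module.End ℝ (X → ℝ)} {K' : g'.Site → g'.Site → ℝ} {K : g.Site → g.Site → ℝ} (hT : HasMajorant blk' T K')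
    (hK : ∀ (x : X) (b : g.Site), ∑ b' ∈ S b, K' (blk' x) b' ≤ K (blk x) b) : HasMajorant blk T K := by
  intro b μ B hμ x
  -- the pieces Δ′(b′)μ are blk′-block supported with the same bound
  have hpiece : ∀ b' : g'.Site, BlockSupp blk' (blockPiece blk' b' μ) b' B := fun b' =>
    blockSupp_blockPiece blk' μ b' B hμ.nonneg fun x' _ => by
      by_cases hx' : blk x' = b
      · exact hμ.bound x' hx'
      · rw [hμ.off x' hx', abs_zero]; exact hμ.nonneg
  -- pieces off `S b` vanish, so the sum over all blocks is the sum over `S b`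
  have hvan : ∀ b' : g'.Site, b' ∉ S b → T (blockPiece blk' b' μ) x = 0 := fun b' hb' => by
    rw [blockPiece_eq_zero_of_not_mem blk blk' S hS hμ hb', map_zero, Pi.zero_apply]
  have hdec : T μ x = ∑ b' ∈ S b, T (blockPiece blk' b' μ) x := by
    conv_lhs => rw [← sum_blockPiece blk' μ, map_sum, Finset.sum_apply]
    exact (Finset.sum_subset (Finset.subset_univ _) fun b' _ hb' => hvan b' hb').symm
  rw [hdec]
  calc |∑ b' ∈ S b, T (blockPiece blk' b' μ) x| ≤ ∑ b' ∈ S b, |T (blockPiece blk' b' μ) x| := Finset.abs_sum_le_sum_abs _ _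
    _ ≤ ∑ b' ∈ S b, K' (blk' x) b' * B := Finset.sum_le_sum fun b' _ => hT b' _ B (hpiece b') x
    _ = (∑ b' ∈ S b, K' (blk' x) b') * B := by rw [Finset.sum_mul]
    _ ≤ K (blk x) b * B := mul_le_mul_of_nonneg_right (hK x b) hμ.nonneg

/-- **Re-blocking an EXPONENTIAL majorant** (the form the resolvent engines consume): if `K′(a′,b′) ≤ C′·w′(a′)·e^{−δd′(a′,b′)}` on the `blk′`-blocks, the weights
compare (`w′(blk′ x) ≤ w(blk x)`), the distances compare on the covering family (`d(blk x, b) ≤ d′(blk′ x, b′) + r` for `b′ ∈ S b` — sub-blocks are at least as far,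
up to `r`), and the covering family is summable at half the rate (`Σ_{b′ ∈ S b} e^{−(δ/2)d′(blk′ x, b′)} ≤ c′`), then `T` has the `blk`-majorant
`C′c′e^{(δ/2)r}·w(a)·e^{−(δ/2)d(a,b)}`.  The three displayed comparisons are the consumer's geometry ([4] (2.60)-type facts for two nested block sequences).
[cite: Balaban1984PropagatorsII, (2.51)–(2.52) p.232 and (2.60) p.234 (bookkeeping across two block structures)] -/
theorem hasMajorant_reblock_exp (blk : X → g.Site) (blk' : X → g'.Site) (S : g.Site → Finset g'.Site) (hS : ∀ x : X, blk' x ∈ S (blk x))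
    {T : Module.End ℝ (X → ℝ)} {K' : g'.Site → g'.Site → ℝ} (hT : HasMajorant blk' T K')
    {C' δ r c' : ℝ} (hC' : 0 ≤ C') (hδ : 0 ≤ δ) (w : g.Site → ℝ) (w' : g'.Site → ℝ) (hw : ∀ x : X, w' (blk' x) ≤ w (blk x))
    (hw' : ∀ a', 0 ≤ w' a')
    (hK' : ∀ a' b' : g'.Site, K' a' b' ≤ C' * w' a' * Real.exp (-(δ * g'.dist a' b')))
    (hdist : ∀ (x : X) (b : g.Site) (b' : g'.Site), b' ∈ S b → g.dist (blk x) b ≤ g'.dist (blk' x) b' + r)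
    (hsum : ∀ (x : X) (b : g.Site), ∑ b' ∈ S b, Real.exp (-(δ / 2 * g'.dist (blk' x) b')) ≤ c') :
    HasMajorant blk T (fun a b => C' * c' * Real.exp (δ / 2 * r) * w a * Real.exp (-(δ / 2 * g.dist a b))) := by
  refine hasMajorant_reblock blk blk' S hS hT fun x b => ?_
  have hwx : 0 ≤ w (blk x) := (hw' (blk' x)).trans (hw x)
  -- termwise: move the weight to `blk x` and split the rate against the distance comparison
  have hterm : ∀ b' ∈ S b, K' (blk' x) b' ≤
      C' * w (blk x) * (Real.exp (δ / 2 * r) * Real.exp (-(δ / 2 * g.dist (blk x) b))) * Real.exp (-(δ / 2 * g'.dist (blk' x) b')) := by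
    intro b' hb'
    refine (hK' (blk' x) b').trans ?_
    have hexp : Real.exp (-(δ * g'.dist (blk' x) b')) ≤
        Real.exp (δ / 2 * r) * Real.exp (-(δ / 2 * g.dist (blk x) b)) * Real.exp (-(δ / 2 * g'.dist (blk' x) b')) := by
      rw [← Real.exp_add, ← Real.exp_add]
      apply Real.exp_le_exp.2
      have h := mul_le_mul_of_nonneg_left (hdist x b b' hb') (by linarith : 0 ≤ δ / 2)
      linarith
    calc C' * w' (blk' x) * Real.exp (-(δ * g'.dist (blk' x) b'))
        ≤ C' * w (blk x) * Real.exp (-(δ * g'.dist (blk' x) b')) :=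
          mul_le_mul_of_nonneg_right (mul_le_mul_of_nonneg_left (hw x) hC') (Real.exp_nonneg _)
      _ ≤ C' * w (blk x) * (Real.exp (δ / 2 * r) * Real.exp (-(δ / 2 * g.dist (blk x) b)) * Real.exp (-(δ / 2 * g'.dist (blk' x) b'))) :=
          mul_le_mul_of_nonneg_left hexp (mul_nonneg hC' hwx)
      _ = C' * w (blk x) * (Real.exp (δ / 2 * r) * Real.exp (-(δ / 2 * g.dist (blk x) b))) * Real.exp (-(δ / 2 * g'.dist (blk' x) b')) := by
          ring
  have hpre : 0 ≤ C' * w (blk x) * (Real.exp (δ / 2 * r) * Real.exp (-(δ / 2 * g.dist (blk x) b))) :=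
    mul_nonneg (mul_nonneg hC' hwx) (mul_nonneg (Real.exp_nonneg _) (Real.exp_nonneg _))
  calc ∑ b' ∈ S b, K' (blk' x) b'
      ≤ ∑ b' ∈ S b, C' * w (blk x) * (Real.exp (δ / 2 * r) * Real.exp (-(δ / 2 * g.dist (blk x) b))) *
          Real.exp (-(δ / 2 * g'.dist (blk' x) b')) := Finset.sum_le_sum hterm
    _ = C' * w (blk x) * (Real.exp (δ / 2 * r) * Real.exp (-(δ / 2 * g.dist (blk x) b))) *
          ∑ b' ∈ S b, Real.exp (-(δ / 2 * g'.dist (blk' x) b')) := by rw [Finset.mul_sum]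
    _ ≤ C' * w (blk x) * (Real.exp (δ / 2 * r) * Real.exp (-(δ / 2 * g.dist (blk x) b))) * c' := mul_le_mul_of_nonneg_left (hsum x b) hpre
    _ = C' * c' * Real.exp (δ / 2 * r) * w (blk x) * Real.exp (-(δ / 2 * g.dist (blk x) b)) := by ring

end Literature.MathematicalPhysics.QuantumFieldTheory.Balaban1983to89.B6MajorantReblock
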